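import Mathlib

/-!
# Crux `RigidityForcesSymmetry.RigidMinimalRepr` (stmt-ValiantsHypothesis-4163), line `registered` —
# stub `stub_rowTwist` (the Koszul row twist is unimodular and keeps the matrix affine)

Route `ValiantsHypothesis/RigidityForcesSymmetry`, crux `RigidMinimalRepr`, skeleton
`Cruxes/RigidMinimalRepr/Lines/registered.lean` (run by the lead as a refutation of the crux), stub `stub_rowTwist`.

**Statement.** Let `A` be a square matrix of polynomials whose rows `w₁, w₂` have the "level-1" shape
`A w₁ = c₁ x_{u₁} e_{c₀}ᵀ + d₁ e_{e₁}ᵀ`, `A w₂ = c₂ x_{u₂} e_{c₀}ᵀ + d₂ e_{e₂}ᵀ`, let `w₃ ∉ {w₁, w₂}` and let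
`α c₂ + β c₁ = 0`.  For the row operation `E = 1 + e_{w₃} qᵀ` with `qᵀ = tα x_{u₁} e_{w₂}ᵀ + tβ x_{u₂} e_{w₁}ᵀ`:
`det E = 1`, and `E A = A + e_{w₃} rᵀ` with the *affine* row `rᵀ = tα d₂ x_{u₁} e_{e₂}ᵀ + tβ d₁ x_{u₂} e_{e₁}ᵀ`.

**Proof.** `E - 1 = e_{w₃} qᵀ` is a rank-one matrix (`Matrix.vecMulVec`), so `det E = 1 + q ⬝ e_{w₃} = 1 + q w₃ = 1`
(`Matrix.det_one_add_replicateCol_mul_replicateRow`; `q w₃ = 0` as `w₃ ≠ w₁, w₂`), and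
`E A = A + e_{w₃} (q A)ᵀ` with `q A = tα x_{u₁} A_{w₂} + tβ x_{u₂} A_{w₁}`, whose pivot (`c₀`) entry is
`t (α c₂ + β c₁) x_{u₁} x_{u₂} = 0`; the remaining entries are the affine row `r`.
-/

set_option autoImplicit false

-- the mandated summit-side namespace repeats a component by design (single-problem summit)
set_option linter.dupNamespace false

noncomputable section

open MvPolynomial

namespace Summit.ValiantsHypothesis.ValiantsHypothesis.Theorems.RigidityForcesSymmetryRigidMinimalRepr

/-- A matrix supported on the single row `w` with entries `q` is the rank-one matrix `e_w qᵀ`. -/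
theorem rowTwist_of_eq_vecMulVec {R : Type*} [Semiring R] {n : ℕ} (w : Fin n) (q : Fin n → R) :
    (Matrix.of fun i j => if i = w then q j else 0) = Matrix.vecMulVec (Pi.single w 1) q := by
  ext i j
  rw [Matrix.of_apply, Matrix.vecMulVec_apply, Pi.single_apply, boole_mul]

/-- The row operation `1 + e_w qᵀ` with `q w = 0` is unimodular: its determinant is `1`. -/
theorem rowTwist_det {R : Type*} [CommRing R] {n : ℕ} (w : Fin n) (q : Fin n → R) (hq : q w = 0) :
    ((1 : Matrix (Fin n) (Fin n) R) + Matrix.of fun i j => if i = w then q j else 0).det = 1 := by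
  rw [rowTwist_of_eq_vecMulVec, Matrix.vecMulVec_eq Unit, Matrix.det_one_add_replicateCol_mul_replicateRow,
    dotProduct_single_one, hq, add_zero]

/-- The row operation `1 + e_w qᵀ` adds the combination `q A` of the rows of `A` to row `w`:
`(1 + e_w qᵀ) A = A + e_w (q A)ᵀ`. -/
theorem rowTwist_mul {R : Type*} [Semiring R] {n : ℕ} (w : Fin n) (q : Fin n → R)
    (A : Matrix (Fin n) (Fin n) R) :
    ((1 : Matrix (Fin n) (Fin n) R) + Matrix.of fun i j => if i = w then q j else 0) * A =
      A + Matrix.of fun i j => if i = w then (Matrix.vecMul q A) j else 0 := by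
  rw [Matrix.add_mul, Matrix.one_mul, rowTwist_of_eq_vecMulVec, rowTwist_of_eq_vecMulVec, Matrix.vecMulVec_mul]

/-- **Stub `stub_rowTwist` of line `registered` for crux `RigidMinimalRepr`** (registered form): for a matrix of
polynomials `A` whose rows `w₁, w₂` are `c_i x_{u_i}` in the pivot column `c₀` plus a constant `d_i` in column
`e_i`, and `α c₂ + β c₁ = 0`, the row twist `E = 1 + e_{w₃} (tα x_{u₁} e_{w₂}ᵀ + tβ x_{u₂} e_{w₁}ᵀ)` (`w₃ ≠ w₁, w₂`)
has `det E = 1` and `E A = A + e_{w₃} (tα d₂ x_{u₁} e_{e₂}ᵀ + tβ d₁ x_{u₂} e_{e₁}ᵀ)` — the quadratic terms in the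
pivot column cancel, so `E A` is still affine. -/
theorem stub_rowTwist {σ : Type*} [DecidableEq σ] {n : ℕ}
    (A : Matrix (Fin n) (Fin n) (MvPolynomial σ ℂ)) (w₁ w₂ w₃ c₀ e₁ e₂ : Fin n) (u₁ u₂ : σ)
    (c₁ c₂ d₁ d₂ α β t : ℂ) (h13 : w₁ ≠ w₃) (h23 : w₂ ≠ w₃)
    (hrow₁ : ∀ j, A w₁ j = (if j = c₀ then C c₁ * X u₁ else 0) + (if j = e₁ then C d₁ else 0))
    (hrow₂ : ∀ j, A w₂ j = (if j = c₀ then C c₂ * X u₂ else 0) + (if j = e₂ then C d₂ else 0))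
    (hαβ : α * c₂ + β * c₁ = 0) :
    ((1 : Matrix (Fin n) (Fin n) (MvPolynomial σ ℂ)) + Matrix.of fun i j => if i = w₃ then
        ((if j = w₂ then C (t * α) * X u₁ else 0) + (if j = w₁ then C (t * β) * X u₂ else 0)) else 0).det = 1 ∧
    ((1 : Matrix (Fin n) (Fin n) (MvPolynomial σ ℂ)) + Matrix.of fun i j => if i = w₃ then
        ((if j = w₂ then C (t * α) * X u₁ else 0) + (if j = w₁ then C (t * β) * X u₂ else 0)) else 0) * A =
      A + Matrix.of fun i j => if i = w₃ then
        ((if j = e₂ then C (t * α * d₂) * X u₁ else 0) + (if j = e₁ then C (t * β * d₁) * X u₂ else 0))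
        else 0 := by
  set q : Fin n → MvPolynomial σ ℂ := fun j =>
    (if j = w₂ then C (t * α) * X u₁ else 0) + (if j = w₁ then C (t * β) * X u₂ else 0) with hq
  refine ⟨rowTwist_det w₃ q ?_, ?_⟩
  · -- `q w₃ = 0` since `w₃ ≠ w₂` and `w₃ ≠ w₁`
    simp only [hq, if_neg (Ne.symm h23), if_neg (Ne.symm h13), add_zero]
  · rw [rowTwist_mul w₃ q A]
    congr 1
    refine congrArg Matrix.of (funext fun i => funext fun j => ?_)
    refine if_congr Iff.rfl ?_ rfl
    -- the `w₃`-row of `E A - A` is `q A = tα x_{u₁} A_{w₂} + tβ x_{u₂} A_{w₁}`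
    have hC : (C α * C c₂ + C β * C c₁ : MvPolynomial σ ℂ) = 0 := by
      rw [← map_mul, ← map_mul, ← map_add, hαβ, map_zero]
    simp only [hq, Matrix.vecMul, dotProduct, add_mul, Finset.sum_add_distrib, ite_mul, zero_mul,
      Finset.sum_ite_eq', Finset.mem_univ, if_true, hrow₁, hrow₂]
    split_ifs <;> simp only [map_mul, mul_add, mul_zero, add_zero, zero_add] <;>
      first
      | ring1
      | linear_combination (C t * X u₁ * X u₂) * hC
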